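import Summits.ValiantsHypothesis.ValiantsHypothesis.Theorems.RyserTripartitionPerLeTripartitionAlgebra
import Literature.Computability.AlgebraicComplexity.SyntacticMultilinearExtension
import HarnessLib

/-!
# ValiantsHypothesis / RyserTripartition — item `PerLeTripartition` (stmt-ValiantsHypothesis-11286):
# the block sub-permanent tables as a syntactically multilinear gate list

The column-subset dynamic programme of the bridge `PerLeTripartition`: for the generic `3k × 3k`
matrix `X`, ALL sub-permanents `q_i(j, S') = Σ_{b} ∏ X(p, b p)` on the first `j` rows of block
`i < 3` (rows `ik ≤ r < ik + j`) and a `j`-set of columns `S'`, `j ≤ k`, are made available in ONE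
plain fan-in-two gate list which is SYNTACTICALLY MULTILINEAR (every product gate multiplies
operands with disjoint syntactic variable sets), the entry `q_i(j, S')` having syntactic support
inside `(first j rows of block i) × (all columns)`, with at most `6 (k+1)² · C(3k, k)` gates
(`tables`).  Recurrence: `q_i(j+1, S') = Σ_{c ∈ S'} X(ik+j, c) · q_i(j, S' ∖ c)`
(`prefixSubperm_succ`), each product joining the fresh row `ik + j` to the first `j` rows — disjoint
supports.  Plumbing: `SynAvail` (`SyntacticMultilinearExtension.lean`).

HONEST FRAMING: bookkeeping toward a support item of a dormant route; nothing here bears on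
`VP ≠ VNP`, which is NOT proved.
-/

-- layout Summits/ValiantsHypothesis/ValiantsHypothesis forces the duplicated namespace component
set_option linter.dupNamespace false

namespace Summit.ValiantsHypothesis.ValiantsHypothesis.Theorems.RyserTripartition

open Finset MvPolynomial Literature.Computability.AlgebraicComplexity
  Literature.Computability.AlgebraicComplexity.ArithCircuit
  Literature.Computability.AlgebraicComplexity.SynAvail
open Literature.Barriers.ValiantsHypothesis (IsPlainGate)

variable {R : Type*} [CommSemiring R]

/-! ### A list-sum helper for availability with support -/

/-- Accumulating a sum `Σ_{x ∈ l} t x` of terms each of which can be made available, with syntactic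
support inside `V`, at the cost of at most `cost` gates (in any good extension): `(cost + 1) · |l|`
gates, support `V`. [folklore] -/
theorem savail_list_sum {σ : Type*} [DecidableEq σ] {ι : Type*} (t : ι → MvPolynomial σ R)
    (V : Finset σ) (cost : ℕ) (l : List ι) :
    ∀ (gs : List (Gate R σ)), (∀ g ∈ gs, g.fanIn ≤ 2 ∧ IsPlainGate g) →
      (∀ (i : ℕ) (args : List (Operand R σ)), gs[i]? = some (.prod args) →
        (args.map (operandVarSet (gateVarSets (gs.take i)))).Pairwise Disjoint) →
      (∀ x ∈ l, ∀ gs' : List (Gate R σ), gs <+: gs' → (∀ g ∈ gs', g.fanIn ≤ 2 ∧ IsPlainGate g) →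
        (∀ (i : ℕ) (args : List (Operand R σ)), gs'[i]? = some (.prod args) →
          (args.map (operandVarSet (gateVarSets (gs'.take i)))).Pairwise Disjoint) →
        ∃ gs'' : List (Gate R σ), gs' <+: gs'' ∧ (∀ g ∈ gs'', g.fanIn ≤ 2 ∧ IsPlainGate g) ∧
          (∀ (i : ℕ) (args : List (Operand R σ)), gs''[i]? = some (.prod args) →
            (args.map (operandVarSet (gateVarSets (gs''.take i)))).Pairwise Disjoint) ∧
          gs''.length ≤ gs'.length + cost ∧
          ∃ u : Operand R σ, u.RefsBelow gs''.length ∧ u.eval (gateValues gs'') = t x ∧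
            operandVarSet (gateVarSets gs'') u ⊆ V) →
      ∃ gs' : List (Gate R σ), gs <+: gs' ∧ (∀ g ∈ gs', g.fanIn ≤ 2 ∧ IsPlainGate g) ∧
        (∀ (i : ℕ) (args : List (Operand R σ)), gs'[i]? = some (.prod args) →
          (args.map (operandVarSet (gateVarSets (gs'.take i)))).Pairwise Disjoint) ∧
        gs'.length ≤ gs.length + (cost + 1) * l.length ∧
        ∃ u : Operand R σ, u.RefsBelow gs'.length ∧ u.eval (gateValues gs') = (l.map t).sum ∧
          operandVarSet (gateVarSets gs') u ⊆ V := by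
  induction l with
  | nil =>
    intro gs hgs hml _
    refine ⟨gs, List.prefix_rfl, hgs, hml, by simp, ?_⟩
    simpa using savail_C gs (0 : R) V
  | cons x l ih =>
    intro gs hgs hml h
    obtain ⟨gs₁, hp₁, hg₁, hm₁, hl₁, hx⟩ := h x (by simp) gs List.prefix_rfl hgs hml
    obtain ⟨gs₂, hp₂, hg₂, hm₂, hl₂, hsum⟩ := ih gs₁ hg₁ hm₁ (fun y hy gs' hp' hg' hm' =>
      h y (by simp [hy]) gs' (hp₁.trans hp') hg' hm')
    obtain ⟨gs₃, hp₃, hg₃, hm₃, hl₃, hu⟩ := sextend_add hg₂ hm₂ (savail_mono hp₂ hx) hsum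
    refine ⟨gs₃, hp₁.trans (hp₂.trans hp₃), hg₃, hm₃, ?_, ?_⟩
    · simp only [List.length_cons]
      calc gs₃.length ≤ gs₂.length + 1 := hl₃
        _ ≤ gs.length + cost + (cost + 1) * l.length + 1 := by omega
        _ = gs.length + (cost + 1) * (l.length + 1) := by ring
    · simpa only [List.map_cons, List.sum_cons, Finset.union_idempotent] using hu

/-! ### One table entry, one stage, all stages -/

/-- The syntactic support allowed for `q_i(j, ·)`: the first `j` rows of block `i`, all columns.
It grows with `j`. [folklore] -/
theorem prefixRows_prod_mono {k i j j' : ℕ} (h : j ≤ j') :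
    ((Finset.univ : Finset (Fin (3 * k))).filter
        (fun r : Fin (3 * k) => i * k ≤ (r : ℕ) ∧ (r : ℕ) < i * k + j)) ×ˢ
        (Finset.univ : Finset (Fin (3 * k))) ⊆
      ((Finset.univ : Finset (Fin (3 * k))).filter
        (fun r : Fin (3 * k) => i * k ≤ (r : ℕ) ∧ (r : ℕ) < i * k + j')) ×ˢ
        (Finset.univ : Finset (Fin (3 * k))) := by
  refine Finset.product_subset_product_left (fun r hr => ?_)
  simp only [Finset.mem_filter, Finset.mem_univ, true_and] at hr ⊢
  omega

/-- **One table entry.** If all `q_i(j, S'')`, `|S''| = j`, are available with support in the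
first `j` rows of block `i`, then `2(j+1)` more gates make `q_i(j+1, S')` (`|S'| = j+1`) available
with support in the first `j+1` rows, keeping the list plain, fan-in-two and syntactically
multilinear. [folklore] -/
theorem table_entry (k : ℕ) {i : ℕ} (hi : i < 3) {j : ℕ} (hj : j < k) (S' : Finset (Fin (3 * k)))
    (hS' : S'.card = j + 1) (gs : List (Gate R (Fin (3 * k) × Fin (3 * k))))
    (hgs : ∀ g ∈ gs, g.fanIn ≤ 2 ∧ IsPlainGate g)
    (hml : ∀ (n : ℕ) (args : List (Operand R (Fin (3 * k) × Fin (3 * k)))),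
      gs[n]? = some (.prod args) →
      (args.map (operandVarSet (gateVarSets (gs.take n)))).Pairwise Disjoint)
    (havail : ∀ S'' : Finset (Fin (3 * k)), S''.card = j →
      ∃ u : Operand R (Fin (3 * k) × Fin (3 * k)), u.RefsBelow gs.length ∧
        u.eval (gateValues gs) =
          (∑ b : ↥((Finset.univ : Finset (Fin (3 * k))).filter
              (fun r : Fin (3 * k) => i * k ≤ (r : ℕ) ∧ (r : ℕ) < i * k + j)) ≃ ↥S'',
            ∏ p : ↥((Finset.univ : Finset (Fin (3 * k))).filter
              (fun r : Fin (3 * k) => i * k ≤ (r : ℕ) ∧ (r : ℕ) < i * k + j)),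
              (X ((p : Fin (3 * k)), ((b p : ↥S'') : Fin (3 * k))) :
                MvPolynomial (Fin (3 * k) × Fin (3 * k)) R)) ∧
        operandVarSet (gateVarSets gs) u ⊆
          ((Finset.univ : Finset (Fin (3 * k))).filter
            (fun r : Fin (3 * k) => i * k ≤ (r : ℕ) ∧ (r : ℕ) < i * k + j)) ×ˢ
            (Finset.univ : Finset (Fin (3 * k)))) :
    ∃ gs' : List (Gate R (Fin (3 * k) × Fin (3 * k))), gs <+: gs' ∧
      (∀ g ∈ gs', g.fanIn ≤ 2 ∧ IsPlainGate g) ∧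
      (∀ (n : ℕ) (args : List (Operand R (Fin (3 * k) × Fin (3 * k)))),
        gs'[n]? = some (.prod args) →
        (args.map (operandVarSet (gateVarSets (gs'.take n)))).Pairwise Disjoint) ∧
      gs'.length ≤ gs.length + 2 * (j + 1) ∧
      ∃ u : Operand R (Fin (3 * k) × Fin (3 * k)), u.RefsBelow gs'.length ∧
        u.eval (gateValues gs') =
          (∑ b : ↥((Finset.univ : Finset (Fin (3 * k))).filter
              (fun r : Fin (3 * k) => i * k ≤ (r : ℕ) ∧ (r : ℕ) < i * k + (j + 1))) ≃ ↥S',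
            ∏ p : ↥((Finset.univ : Finset (Fin (3 * k))).filter
              (fun r : Fin (3 * k) => i * k ≤ (r : ℕ) ∧ (r : ℕ) < i * k + (j + 1))),
              (X ((p : Fin (3 * k)), ((b p : ↥S') : Fin (3 * k))) :
                MvPolynomial (Fin (3 * k) × Fin (3 * k)) R)) ∧
        operandVarSet (gateVarSets gs') u ⊆
          ((Finset.univ : Finset (Fin (3 * k))).filter
            (fun r : Fin (3 * k) => i * k ≤ (r : ℕ) ∧ (r : ℕ) < i * k + (j + 1))) ×ˢ
            (Finset.univ : Finset (Fin (3 * k))) := by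
  classical
  -- the recurrence, as a list sum over the columns `c ∈ S'`
  set p₀ : Fin (3 * k) := ⟨i * k + j, blockRow_lt hi hj⟩ with hp₀def
  set V := ((Finset.univ : Finset (Fin (3 * k))).filter
      (fun r : Fin (3 * k) => i * k ≤ (r : ℕ) ∧ (r : ℕ) < i * k + (j + 1))) ×ˢ
      (Finset.univ : Finset (Fin (3 * k))) with hVdef
  set t : Fin (3 * k) → MvPolynomial (Fin (3 * k) × Fin (3 * k)) R := fun c =>
    X (p₀, c) *
      ∑ b : ↥((Finset.univ : Finset (Fin (3 * k))).filter
          (fun r : Fin (3 * k) => i * k ≤ (r : ℕ) ∧ (r : ℕ) < i * k + j)) ≃ ↥(S'.erase c),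
        ∏ p : ↥((Finset.univ : Finset (Fin (3 * k))).filter
          (fun r : Fin (3 * k) => i * k ≤ (r : ℕ) ∧ (r : ℕ) < i * k + j)),
          (X ((p : Fin (3 * k)), ((b p : ↥(S'.erase c)) : Fin (3 * k))) :
            MvPolynomial (Fin (3 * k) × Fin (3 * k)) R) with htdef
  have hrec := prefixSubperm_succ (R := R) hi hj S'
  have hsum : (S'.toList.map t).sum =
      ∑ c ∈ S', t c := Finset.sum_map_toList S' t
  -- each term costs one product gate
  obtain ⟨gs', hp', hg', hm', hl', u, hu, hue, huV⟩ := savail_list_sum t V 1 S'.toList gs hgs hml (by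
    intro c hc gs₁ hp₁ hg₁ hm₁
    rw [Finset.mem_toList] at hc
    have hcard : (S'.erase c).card = j := by rw [Finset.card_erase_of_mem hc, hS']; rfl
    obtain ⟨gs₂, hp₂, hg₂, hm₂, hl₂, hx⟩ := sextend_mul hg₁ hm₁
      (V₁ := ({p₀} : Finset (Fin (3 * k))) ×ˢ (Finset.univ : Finset (Fin (3 * k))))
      (V₂ := ((Finset.univ : Finset (Fin (3 * k))).filter
        (fun r : Fin (3 * k) => i * k ≤ (r : ℕ) ∧ (r : ℕ) < i * k + j)) ×ˢ
        (Finset.univ : Finset (Fin (3 * k))))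
      (by
        rw [Finset.disjoint_product, Finset.disjoint_singleton_left]
        exact Or.inl (not_mem_prefixRows hi hj))
      (savail_X gs₁ (p₀, c) (by simp))
      (savail_mono hp₁ (havail (S'.erase c) hcard))
    refine ⟨gs₂, hp₂, hg₂, hm₂, hl₂, savail_weaken ?_ hx⟩
    rw [hVdef]
    refine Finset.union_subset ?_ (prefixRows_prod_mono (Nat.le_succ j))
    refine Finset.product_subset_product_left ?_
    rw [Finset.singleton_subset_iff]
    exact mem_prefixRows_succ hi hj)
  refine ⟨gs', hp', hg', hm', ?_, u, hu, ?_, huV⟩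
  · rw [Finset.length_toList, hS'] at hl'; omega
  · rw [hue, hsum, hrec]

/-- **One stage of the table.** From all `q_i(j, ·)` (every `i < 3`, every `j`-set) to all
`q_i(j+1, ·)`: at most `6 (j+1) · C(3k, j+1)` gates. [folklore] -/
theorem table_stage (k : ℕ) {j : ℕ} (hj : j < k) (gs : List (Gate R (Fin (3 * k) × Fin (3 * k))))
    (hgs : ∀ g ∈ gs, g.fanIn ≤ 2 ∧ IsPlainGate g)
    (hml : ∀ (n : ℕ) (args : List (Operand R (Fin (3 * k) × Fin (3 * k)))),
      gs[n]? = some (.prod args) →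
      (args.map (operandVarSet (gateVarSets (gs.take n)))).Pairwise Disjoint)
    (havail : ∀ i < 3, ∀ S'' : Finset (Fin (3 * k)), S''.card = j →
      ∃ u : Operand R (Fin (3 * k) × Fin (3 * k)), u.RefsBelow gs.length ∧
        u.eval (gateValues gs) =
          (∑ b : ↥((Finset.univ : Finset (Fin (3 * k))).filter
              (fun r : Fin (3 * k) => i * k ≤ (r : ℕ) ∧ (r : ℕ) < i * k + j)) ≃ ↥S'',
            ∏ p : ↥((Finset.univ : Finset (Fin (3 * k))).filter
              (fun r : Fin (3 * k) => i * k ≤ (r : ℕ) ∧ (r : ℕ) < i * k + j)),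
              (X ((p : Fin (3 * k)), ((b p : ↥S'') : Fin (3 * k))) :
                MvPolynomial (Fin (3 * k) × Fin (3 * k)) R)) ∧
        operandVarSet (gateVarSets gs) u ⊆
          ((Finset.univ : Finset (Fin (3 * k))).filter
            (fun r : Fin (3 * k) => i * k ≤ (r : ℕ) ∧ (r : ℕ) < i * k + j)) ×ˢ
            (Finset.univ : Finset (Fin (3 * k)))) :
    ∃ gs' : List (Gate R (Fin (3 * k) × Fin (3 * k))), gs <+: gs' ∧
      (∀ g ∈ gs', g.fanIn ≤ 2 ∧ IsPlainGate g) ∧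
      (∀ (n : ℕ) (args : List (Operand R (Fin (3 * k) × Fin (3 * k)))),
        gs'[n]? = some (.prod args) →
        (args.map (operandVarSet (gateVarSets (gs'.take n)))).Pairwise Disjoint) ∧
      gs'.length ≤ gs.length +
        6 * (j + 1) * ((Finset.univ : Finset (Fin (3 * k))).powersetCard (j + 1)).card ∧
      ∀ i < 3, ∀ S' : Finset (Fin (3 * k)), S'.card = j + 1 →
        ∃ u : Operand R (Fin (3 * k) × Fin (3 * k)), u.RefsBelow gs'.length ∧
          u.eval (gateValues gs') =
            (∑ b : ↥((Finset.univ : Finset (Fin (3 * k))).filter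
                (fun r : Fin (3 * k) => i * k ≤ (r : ℕ) ∧ (r : ℕ) < i * k + (j + 1))) ≃ ↥S',
              ∏ p : ↥((Finset.univ : Finset (Fin (3 * k))).filter
                (fun r : Fin (3 * k) => i * k ≤ (r : ℕ) ∧ (r : ℕ) < i * k + (j + 1))),
                (X ((p : Fin (3 * k)), ((b p : ↥S') : Fin (3 * k))) :
                  MvPolynomial (Fin (3 * k) × Fin (3 * k)) R)) ∧
          operandVarSet (gateVarSets gs') u ⊆
            ((Finset.univ : Finset (Fin (3 * k))).filter
              (fun r : Fin (3 * k) => i * k ≤ (r : ℕ) ∧ (r : ℕ) < i * k + (j + 1))) ×ˢ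
              (Finset.univ : Finset (Fin (3 * k))) := by
  classical
  -- enumerate the (j+1)-sets and run the three blocks for each
  set L := ((Finset.univ : Finset (Fin (3 * k))).powersetCard (j + 1)).toList with hLdef
  -- target predicate for the l-th set
  obtain ⟨gs', hp', hg', hm', hl', hQ⟩ := siterate_extend
    (Q := fun l gs' => ∀ i < 3,
      ∃ u : Operand R (Fin (3 * k) × Fin (3 * k)), u.RefsBelow gs'.length ∧
        u.eval (gateValues gs') =
          (∑ b : ↥((Finset.univ : Finset (Fin (3 * k))).filter
              (fun r : Fin (3 * k) => i * k ≤ (r : ℕ) ∧ (r : ℕ) < i * k + (j + 1))) ≃ ↥(L.getD l ∅),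
            ∏ p : ↥((Finset.univ : Finset (Fin (3 * k))).filter
              (fun r : Fin (3 * k) => i * k ≤ (r : ℕ) ∧ (r : ℕ) < i * k + (j + 1))),
              (X ((p : Fin (3 * k)), ((b p : ↥(L.getD l ∅)) : Fin (3 * k))) :
                MvPolynomial (Fin (3 * k) × Fin (3 * k)) R)) ∧
        operandVarSet (gateVarSets gs') u ⊆
          ((Finset.univ : Finset (Fin (3 * k))).filter
            (fun r : Fin (3 * k) => i * k ≤ (r : ℕ) ∧ (r : ℕ) < i * k + (j + 1))) ×ˢ
            (Finset.univ : Finset (Fin (3 * k))))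
    (fun l gs₁ gs₂ h hQ i hi => savail_mono h (hQ i hi)) (6 * (j + 1)) gs hgs hml L.length (by
      intro l hl gs₁ hp₁ hg₁ hm₁ _
      have hmem : L.getD l ∅ ∈ (Finset.univ : Finset (Fin (3 * k))).powersetCard (j + 1) := by
        rw [← Finset.mem_toList, ← hLdef, List.getD_eq_getElem?_getD, List.getElem?_eq_getElem hl,
          Option.getD_some]
        exact List.getElem_mem hl
      have hcard : (L.getD l ∅).card = j + 1 := (Finset.mem_powersetCard.mp hmem).2
      -- block 0, then 1, then 2
      obtain ⟨gsa, hpa, hga, hma, hla, hua⟩ := table_entry k (i := 0) (by norm_num) hj (L.getD l ∅)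
        hcard gs₁ hg₁ hm₁ (fun S'' hS'' => savail_mono hp₁ (havail 0 (by norm_num) S'' hS''))
      obtain ⟨gsb, hpb, hgb, hmb, hlb, hub⟩ := table_entry k (i := 1) (by norm_num) hj (L.getD l ∅)
        hcard gsa hga hma
        (fun S'' hS'' => savail_mono (hp₁.trans hpa) (havail 1 (by norm_num) S'' hS''))
      obtain ⟨gsc, hpc, hgc, hmc, hlc, huc⟩ := table_entry k (i := 2) (by norm_num) hj (L.getD l ∅)
        hcard gsb hgb hmb
        (fun S'' hS'' => savail_mono (hp₁.trans (hpa.trans hpb)) (havail 2 (by norm_num) S'' hS''))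
      refine ⟨gsc, hpa.trans (hpb.trans hpc), hgc, hmc, by omega, ?_⟩
      intro i hi
      interval_cases i
      · exact savail_mono (hpb.trans hpc) hua
      · exact savail_mono hpc hub
      · exact huc)
  refine ⟨gs', hp', hg', hm', ?_, ?_⟩
  · rw [hLdef, Finset.length_toList] at hl'
    exact hl'
  · intro i hi S' hS'
    have hmem : S' ∈ L := by
      rw [hLdef, Finset.mem_toList, Finset.mem_powersetCard]
      exact ⟨Finset.subset_univ _, hS'⟩
    obtain ⟨l, hl, hlS⟩ := List.getElem_of_mem hmem
    have hget : L.getD l ∅ = S' := by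
      rw [List.getD_eq_getElem?_getD, List.getElem?_eq_getElem hl, Option.getD_some, hlS]
    have := hQ l hl i hi
    rw [hget] at this
    exact this

/-- Binomial monotonicity below the middle: `C(3k, j) ≤ C(3k, k)` for `j ≤ k`. [folklore] -/
theorem choose_three_mul_le_choose (k : ℕ) : ∀ j ≤ k, Nat.choose (3 * k) j ≤ Nat.choose (3 * k) k := by
  -- decreasing induction from `k`
  have step : ∀ d j : ℕ, j + d = k → Nat.choose (3 * k) j ≤ Nat.choose (3 * k) k := by
    intro d
    induction d with
    | zero => intro j h; rw [Nat.add_zero] at h; rw [h]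
    | succ d ih =>
      intro j h
      have hlt : j < 3 * k / 2 := by omega
      exact (Nat.choose_le_succ_of_lt_half_left hlt).trans (ih (j + 1) (by omega))
  intro j hj
  exact step (k - j) j (by omega)

/-- The number of `j`-subsets of `Fin (3k)` is at most `C(3k, k)` for `j ≤ k`. [folklore] -/
theorem card_powersetCard_le (k : ℕ) {j : ℕ} (hj : j ≤ k) :
    ((Finset.univ : Finset (Fin (3 * k))).powersetCard j).card ≤ Nat.choose (3 * k) k := by
  rw [Finset.card_powersetCard, Finset.card_univ, Fintype.card_fin]
  exact choose_three_mul_le_choose k j hj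

/-- **The sub-permanent tables.** One plain, fan-in-two, SYNTACTICALLY MULTILINEAR gate list of at
most `6 (k+1)² · C(3k, k)` gates in which every block sub-permanent `q_i(k, S)` of the generic
`3k × 3k` matrix (rows of block `i < 3` = `{ik ≤ r < ik + k}`, columns a `k`-set `S`) is available,
with syntactic support inside `(rows of block i) × (all columns)`. [folklore] -/
theorem tables (k : ℕ) :
    ∃ gs : List (Gate R (Fin (3 * k) × Fin (3 * k))),
      (∀ g ∈ gs, g.fanIn ≤ 2 ∧ IsPlainGate g) ∧
      (∀ (n : ℕ) (args : List (Operand R (Fin (3 * k) × Fin (3 * k)))),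
        gs[n]? = some (.prod args) →
        (args.map (operandVarSet (gateVarSets (gs.take n)))).Pairwise Disjoint) ∧
      gs.length ≤ 6 * (k + 1) ^ 2 * Nat.choose (3 * k) k ∧
      ∀ i < 3, ∀ S : Finset (Fin (3 * k)), S.card = k →
        ∃ u : Operand R (Fin (3 * k) × Fin (3 * k)), u.RefsBelow gs.length ∧
          u.eval (gateValues gs) =
            (∑ b : ↥((Finset.univ : Finset (Fin (3 * k))).filter
                (fun r : Fin (3 * k) => i * k ≤ (r : ℕ) ∧ (r : ℕ) < i * k + k)) ≃ ↥S,
              ∏ p : ↥((Finset.univ : Finset (Fin (3 * k))).filter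
                (fun r : Fin (3 * k) => i * k ≤ (r : ℕ) ∧ (r : ℕ) < i * k + k)),
                (X ((p : Fin (3 * k)), ((b p : ↥S) : Fin (3 * k))) :
                  MvPolynomial (Fin (3 * k) × Fin (3 * k)) R)) ∧
          operandVarSet (gateVarSets gs) u ⊆
            ((Finset.univ : Finset (Fin (3 * k))).filter
              (fun r : Fin (3 * k) => i * k ≤ (r : ℕ) ∧ (r : ℕ) < i * k + k)) ×ˢ
              (Finset.univ : Finset (Fin (3 * k))) := by
  classical
  have key : ∀ j ≤ k, ∃ gs : List (Gate R (Fin (3 * k) × Fin (3 * k))),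
      (∀ g ∈ gs, g.fanIn ≤ 2 ∧ IsPlainGate g) ∧
      (∀ (n : ℕ) (args : List (Operand R (Fin (3 * k) × Fin (3 * k)))),
        gs[n]? = some (.prod args) →
        (args.map (operandVarSet (gateVarSets (gs.take n)))).Pairwise Disjoint) ∧
      gs.length ≤ 6 * (k + 1) * Nat.choose (3 * k) k * j ∧
      ∀ i < 3, ∀ S : Finset (Fin (3 * k)), S.card = j →
        ∃ u : Operand R (Fin (3 * k) × Fin (3 * k)), u.RefsBelow gs.length ∧
          u.eval (gateValues gs) =
            (∑ b : ↥((Finset.univ : Finset (Fin (3 * k))).filter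
                (fun r : Fin (3 * k) => i * k ≤ (r : ℕ) ∧ (r : ℕ) < i * k + j)) ≃ ↥S,
              ∏ p : ↥((Finset.univ : Finset (Fin (3 * k))).filter
                (fun r : Fin (3 * k) => i * k ≤ (r : ℕ) ∧ (r : ℕ) < i * k + j)),
                (X ((p : Fin (3 * k)), ((b p : ↥S) : Fin (3 * k))) :
                  MvPolynomial (Fin (3 * k) × Fin (3 * k)) R)) ∧
          operandVarSet (gateVarSets gs) u ⊆
            ((Finset.univ : Finset (Fin (3 * k))).filter
              (fun r : Fin (3 * k) => i * k ≤ (r : ℕ) ∧ (r : ℕ) < i * k + j)) ×ˢ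
              (Finset.univ : Finset (Fin (3 * k))) := by
    intro j
    induction j with
    | zero =>
      intro _
      refine ⟨[], by simp, prodInv_nil, by simp, ?_⟩
      intro i hi S hS
      rw [Finset.card_eq_zero] at hS
      subst hS
      have h := savail_C (σ := Fin (3 * k) × Fin (3 * k)) ([] : List (Gate R _)) (1 : R)
        (((Finset.univ : Finset (Fin (3 * k))).filter
          (fun r : Fin (3 * k) => i * k ≤ (r : ℕ) ∧ (r : ℕ) < i * k + 0)) ×ˢ
          (Finset.univ : Finset (Fin (3 * k))))
      rw [C_1, ← prefixSubperm_zero (R := R) (k := k) i] at h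
      exact h
    | succ j ih =>
      intro hjk
      obtain ⟨gs, hgs, hml, hlen, hav⟩ := ih (Nat.le_of_succ_le hjk)
      obtain ⟨gs', -, hg', hm', hl', hav'⟩ := table_stage k (Nat.lt_of_succ_le hjk) gs hgs hml hav
      refine ⟨gs', hg', hm', ?_, hav'⟩
      have hc := card_powersetCard_le k hjk
      have h1 : 6 * (j + 1) * ((Finset.univ : Finset (Fin (3 * k))).powersetCard (j + 1)).card ≤
          6 * (k + 1) * Nat.choose (3 * k) k :=
        Nat.mul_le_mul (Nat.mul_le_mul_left _ (by omega)) hc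
      calc gs'.length ≤ gs.length + 6 * (j + 1) *
            ((Finset.univ : Finset (Fin (3 * k))).powersetCard (j + 1)).card := hl'
        _ ≤ 6 * (k + 1) * Nat.choose (3 * k) k * j + 6 * (k + 1) * Nat.choose (3 * k) k :=
            Nat.add_le_add hlen h1
        _ = 6 * (k + 1) * Nat.choose (3 * k) k * (j + 1) := by ring
  obtain ⟨gs, hgs, hml, hlen, hav⟩ := key k le_rfl
  refine ⟨gs, hgs, hml, ?_, hav⟩
  calc gs.length ≤ 6 * (k + 1) * Nat.choose (3 * k) k * k := hlen
    _ ≤ 6 * (k + 1) * Nat.choose (3 * k) k * (k + 1) := Nat.mul_le_mul_left _ (Nat.le_succ k)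
    _ = 6 * (k + 1) ^ 2 * Nat.choose (3 * k) k := by ring

end Summit.ValiantsHypothesis.ValiantsHypothesis.Theorems.RyserTripartition
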